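import Summits.NavierStokesRegularity.NavierStokesRegularity.Theorems.SoloSalvageMagsanop2026Enstrophy
import Literature.Analysis.FluidPDE.BKMClassGradientContinuity
import Literature.Analysis.FluidPDE.LerayLocalRegularH1Proofs
import Literature.Analysis.FluidPDE.LerayH1Continuation
import HarnessLib

/-!
# Solo salvage for claim C145 `Magsanop2026` (cell `ns-claims`, D-0090), part 2: continuity of `‖ω(t)‖²` at
# the initial time and the full `Step_L22_ineq`

Continuation of `Theorems/SoloSalvageMagsanop2026Enstrophy.lean` (the interior part: `slice_ineq`,
`hasDerivAt_vortSq`, `step_L22_ineq_interior`). Here the remaining clause of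
`Literature.Claims.NS.Magsanop2026.Step_L22_ineq` — continuity of `t ↦ ‖ω(t)‖²_{L²}` on `[0,T)` for a datum that is
only `H¹ ∩ C^∞` — is proved, and the step is DISCHARGED (`step_L22_ineq_holds`), with the absolute constant
`C = 4K⁶ + 1` (`K` = Mathlib's `SNormLESNormFDerivOfEqConst` for `H¹(ℝ³) ⊂ L⁶`). The head of ADJUDICATED #132
(`Step_Thm2`, class false lemma) is untouched; this is the TRUE column.

Route at `t = 0⁺`: Tao's almost regular `H¹` solution `v` from `u(0)` (`tao2011_H1_local_almost_regular_holds`,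
Thm 5.4 (i)–(ii) + Prop 5.6, PROVED in the tree) is `H¹`-continuous on a window `[0,T₁]`; the class solution is
Leray–Hopf and `L²`-continuous there (`isLerayHopfOn_of_finiteEnergy`, Lemma 8.1) and equals `v(t)` a.e. for
`t ∈ (0,T₁]` by the tree's Prodi–Serrin theorem (`serrin_weak_strong_uniqueness_holds`), so `t ↦ ∫⁻|∇u(t)|²_F` is
continuous on `[0,T₁]`; for `t > 0` it equals `∫⁻|ω(t)|²` (the `H²` div–curl identity
`lintegral_frobeniusNormSq_fderiv_eq_lintegral_curl_sq`), and AT `t = 0` the identity follows from the `H¹`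
inequality `∫⁻|∇u₀|²_F ≤ ∫⁻|ω₀|²` (`lintegral_frobeniusNormSq_fderiv_le_lintegral_sq_norm_curl`) together with
Fatou's lemma along `tₙ ↓ 0`. Salvage seat `ns-claims-salvage-p1` g4 (cross-row TRUE column; C145 salvage of
record salvage-p4 g4 consented 14:38Z). Nothing disputed is asserted.

WHAT THIS IS NOT: not a claim about NS regularity or blow-up; not a claim about any author beyond the typed
locator.
-/

set_option linter.dupNamespace false

noncomputable section

open Set Filter MeasureTheory Topology InnerProductSpace
open scoped RealInnerProductSpace ENNReal NNReal ContDiff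

namespace Summit.NavierStokesRegularity.NavierStokesRegularity.Theorems.Magsanop2026Enstrophy

open Literature.Analysis.FluidPDE
open Literature.Claims.NS.Magsanop2026 (E3 IsSol IsDatum vortSq gradSq Step_L22_ineq)
open Literature.Claims.NS.LucardoOlivaes2026 (ensq stretchI)
open Literature.Claims.NS.Chae2007 (IsLocalSolution)

variable {ν T : ℝ} {u₀ : E3 → E3} {u : ℝ → E3 → E3} {p : ℝ → E3 → ℝ}

/-! ## 3. Continuity of `‖ω(t)‖²` on `[0,T)` and the full `Step_L22_ineq`

At interior times the continuity is the differentiability of §2. At `t = 0⁺` (datum only `H¹ ∩ C^∞`): Tao's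
almost regular `H¹` solution `v` from `u(0)` (`tao2011_H1_local_almost_regular_holds`, Thm 5.4 + Prop 5.6) is
`H¹`-continuous on `[0,T₁]`; the class solution is Leray–Hopf and `L²`-continuous
(`isLerayHopfOn_of_finiteEnergy`, Lemma 8.1) and coincides with `v` a.e. at every `t ∈ (0,T₁]` by the tree's
Prodi–Serrin theorem, so `t ↦ ∫⁻|∇u(t)|²_F` is continuous on `[0,T₁]`; for `t > 0`, `∫⁻|∇u(t)|²_F = ∫⁻|ω(t)|²`
(div–curl identity in `H²`), and AT `t = 0` the same identity follows from the `H¹` inequality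
`∫⁻|∇u₀|²_F ≤ ∫⁻|ω₀|²` (`lintegral_frobeniusNormSq_fderiv_le_lintegral_sq_norm_curl`) and Fatou along `tₙ ↓ 0`. -/

/-- All Sobolev seminorms of an interior slice are finite. [cite: Tao2011, Cor. 11.1] -/
theorem sobolev_slice (hν : 0 < ν) (hsol : IsSol ν T u₀ u p) {t : ℝ} (ht : t ∈ Ioo 0 T) (n : ℕ) :
    ∫⁻ x, ‖iteratedFDeriv ℝ n (u t) x‖ₑ ^ 2 < ⊤ := by
  have hB := hasBoundedSobolevNormsOn_interior hν hsol (σ := t / 2) (T' := (t + T) / 2)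
    (by linarith [ht.1]) (by linarith [ht.1, ht.2]) (by linarith [ht.2])
  obtain ⟨C, hC⟩ := hB n
  exact (hC t ⟨by linarith [ht.1], by linarith [ht.2]⟩).trans_lt ENNReal.coe_lt_top

/-- At interior times the weak dissipation is the enstrophy: `∫⁻|∇u(t)|²_F = ∫⁻|ω(t)|²` (`H²` div–curl identity).
[cite: DoeringGibbon1995, §1.4 eq. (1.4.20)–(1.4.21)] -/
theorem lintegral_frob_eq_lintegral_curl_of_pos (hν : 0 < ν) (hsol : IsSol ν T u₀ u p) {t : ℝ}
    (ht : t ∈ Ioo 0 T) :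
    ∫⁻ x, ENNReal.ofReal (frobeniusNormSq (fderiv ℝ (u t) x)) = ∫⁻ x, ‖curl (u t) x‖ₑ ^ 2 := by
  have htS : t ∈ Ico 0 T := ⟨ht.1.le, ht.2⟩
  have hsm : ContDiff ℝ 2 (u t) := (hsol.classical.contDiff_velocity htS).of_le (by norm_cast)
  have h0 : ∫⁻ x, ‖u t x‖ₑ ^ 2 < ⊤ := by
    refine lt_of_le_of_lt (le_of_eq (lintegral_congr fun x => ?_)) (sobolev_slice hν hsol ht 0)
    rw [← ofReal_norm, ← ofReal_norm, norm_iteratedFDeriv_zero]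
  exact lintegral_frobeniusNormSq_fderiv_eq_lintegral_curl_sq hsm (hsol.classical.divFree t htS) h0
    (sobolev_slice hν hsol ht 1) (sobolev_slice hν hsol ht 2)

/-- The enstrophy of a slice as a real number: `vortSq (u t) = (∫⁻‖ω(t)‖ₑ²).toReal`, for every `t ∈ [0,T)`
(`Dω ∈ L²` at `t = 0` from the `H¹` datum, at `t > 0` from the interior regularity). [folklore] -/
theorem vortSq_eq_toReal (hν : 0 < ν) (hsol : IsSol ν T u₀ u p) (hd : IsDatum u₀) {t : ℝ} (ht : t ∈ Ico 0 T) :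
    vortSq (u t) = (∫⁻ x, ‖curl (u t) x‖ₑ ^ 2).toReal := by
  have hsm : ContDiff ℝ 2 (u t) := (hsol.classical.contDiff_velocity ht).of_le (by norm_cast)
  have h1 : ∫⁻ x, ‖iteratedFDeriv ℝ 1 (u t) x‖ₑ ^ 2 < ⊤ := by
    rcases ht.1.eq_or_lt with h0 | hpos
    · rw [← h0, hsol.initial]; exact hd.2.2 1 le_rfl
    · exact sobolev_slice hν hsol ⟨hpos, ht.2⟩ 1
  rw [lintegral_enorm_curl_sq_eq_ofReal_integral hsm h1, ENNReal.toReal_ofReal]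
  · rfl
  · exact integral_nonneg fun x => by positivity

/-- **`H¹`-continuity at the initial time transfers to the class solution**: on a short window `[0,T₁]`,
`t ↦ ∫⁻|∇u(t)|²_F` is continuous (Tao's almost regular solution from `u(0)` is `H¹`-regular on `[0,T₁]` and equals
`u(t)` a.e. for `t ∈ (0,T₁]` by weak–strong uniqueness; the class solution is `L²`-continuous).
[cite: Tao2011, Thm. 5.4 (i)-(ii) and Prop. 5.6] -/
theorem exists_continuousOn_lintegral_frob (hν : 0 < ν) (hsol : IsSol ν T u₀ u p) (hd : IsDatum u₀)
    (hT : 0 < T) :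
    ∃ T₁ : ℝ, 0 < T₁ ∧ T₁ < T ∧
      ContinuousOn (fun t => ∫⁻ x, ENNReal.ofReal (frobeniusNormSq (fderiv ℝ (u t) x))) (Icc 0 T₁) := by
  obtain ⟨c, hc, hreg⟩ := tao2011_H1_local_almost_regular_holds
  -- the datum `u 0`
  have h0S : (0 : ℝ) ∈ Ico 0 T := ⟨le_rfl, hT⟩
  have hus : ContDiff ℝ ∞ (u 0) := hsol.classical.contDiff_velocity h0S
  have hus1 : ContDiff ℝ 1 (u 0) := hus.of_le (by norm_cast)
  have hL2 : ∫⁻ x, ‖u 0 x‖ₑ ^ 2 < ⊤ := by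
    obtain ⟨A, hA, hAt⟩ := hsol.energy
    exact (hAt 0 h0S).trans_lt hA
  have hD1 : ∫⁻ x, ENNReal.ofReal (frobeniusNormSq (fderiv ℝ (u 0) x)) < ⊤ := by
    refine lt_of_le_of_lt (lintegral_frobeniusNormSq_le_three_mul_iteratedFDeriv_one (u 0)) ?_
    rw [hsol.initial]
    exact ENNReal.mul_lt_top (by simp) (hd.2.2 1 le_rfl)
  have hu₀ : MemLp (u 0) 2 volume := memLp_two_of_lintegral_lt_top hus.continuous hL2
  have hdiv : IsWeaklyDivFree (u 0) :=
    VectorCalculus.IsDivFree.isWeaklyDivFree_holds (hsol.classical.divFree 0 h0S) hus1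
  set A₀ : ℝ≥0∞ := (∫⁻ x, ‖u 0 x‖ₑ ^ 2) + ∫⁻ x, ENNReal.ofReal (frobeniusNormSq (fderiv ℝ (u 0) x)) with hA₀
  have hA₀top : A₀ ≠ ⊤ := (ENNReal.add_lt_top.2 ⟨hL2, hD1⟩).ne
  set A : ℝ := A₀.toReal with hA
  have hA0 : 0 ≤ A := ENNReal.toReal_nonneg
  have hH1 : eH1NormSq (u 0) ≤ ENNReal.ofReal A := by
    rw [hA, ENNReal.ofReal_toReal hA₀top, eH1NormSq_def]
    exact add_le_add le_rfl (eWeakGradL2Sq_le_of_hasWeakGradient (hasWeakGradient_fderiv_of_contDiff hus1))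
  -- the window
  set T₁ : ℝ := min (T / 2) (c * ν ^ 3 / (A ^ 2 + 1)) with hT₁
  have hT₁pos : 0 < T₁ := lt_min (by linarith) (by positivity)
  have hT₁T : T₁ < T := (min_le_left _ _).trans_lt (by linarith)
  have hsmall : A ^ 2 * T₁ ≤ c * ν ^ 3 := by
    calc A ^ 2 * T₁ ≤ A ^ 2 * (c * ν ^ 3 / (A ^ 2 + 1)) :=
          mul_le_mul_of_nonneg_left (min_le_right _ _) (sq_nonneg A)
      _ ≤ (A ^ 2 + 1) * (c * ν ^ 3 / (A ^ 2 + 1)) :=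
          mul_le_mul_of_nonneg_right (by linarith) (by positivity)
      _ = c * ν ^ 3 := by field_simp
  refine ⟨T₁, hT₁pos, hT₁T, ?_⟩
  -- the class solution on the closed window: Leray–Hopf and `L²`-continuous
  have hcl : IsClassicalNSSolutionOn (Icc 0 T₁) ν 0 u p :=
    hsol.classical.mono (Icc_subset_Ico_right hT₁T) (uniqueDiffOn_Icc hT₁pos)
  have hfe : ∃ C : ℝ≥0∞, C < ⊤ ∧ ∀ t ∈ Icc 0 T₁, ∫⁻ x, ‖u t x‖ₑ ^ 2 ≤ C := by
    obtain ⟨A', hA', hAt⟩ := hsol.energy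
    exact ⟨A', hA', fun t ht => hAt t ⟨ht.1, ht.2.trans_lt hT₁T⟩⟩
  obtain ⟨hLHu, hcont⟩ := isLerayHopfOn_of_finiteEnergy hcl hν hT₁pos hfe
  -- Tao's almost regular solution from `u 0` and weak–strong uniqueness
  obtain ⟨v, hLHv, hv0, hregv, -⟩ := hreg hν hT₁pos hu₀ hdiv hA0 hH1 hsmall
  have hS : MemLqLp ∞ 6 v (Ioo 0 T₁) :=
    memLqLp_top_six_of_isH1RegularOn_Icc hregv fun t ht => hLHv.memLp t ht
  have hqr : 2 / (∞ : ℝ≥0∞) + 3 / 6 ≤ 1 := by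
    rw [ENNReal.div_top, zero_add]
    exact ENNReal.div_le_of_le_mul (by norm_num)
  have hae : ∀ t ∈ Ioc 0 T₁, u t =ᵐ[volume] v t :=
    serrin_weak_strong_uniqueness_holds hν hT₁pos hLHv hu₀ (q := ∞) (r := 6) (by norm_num) hqr hS hLHu
  have heq : ∀ t ∈ Icc 0 T₁, eH1NormSq (u t) = eH1NormSq (v t) := by
    intro t ht
    rcases ht.1.eq_or_lt with h0 | hpos
    · rw [← h0, hv0]
    · exact eH1NormSq_congr_ae (hae t ⟨hpos, ht.2⟩)
  have hregu : IsH1RegularOn (Icc 0 T₁) u :=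
    ⟨fun t ht => (heq t ht) ▸ hregv.1 t ht, hregv.2.congr fun t ht => heq t ht⟩
  have hW := hregu.continuousOn_eWeakGradL2Sq hcont
  refine hW.congr fun t ht => ?_
  exact (eWeakGradL2Sq_eq_of_hasWeakGradient (hasWeakGradient_fderiv_of_contDiff
    ((hcl.contDiff_velocity ht).of_le (by norm_cast)))).symm

/-- **The enstrophy at `t = 0` is attained continuously: `∫⁻|∇u₀|²_F = ∫⁻|ω₀|²` and `∫⁻|ω(t)|² → ∫⁻|ω₀|²` as
`t → 0⁺`.** Fatou along `tₙ ↓ 0` gives `∫⁻|ω₀|² ≤ liminf ∫⁻|ω(tₙ)|² = lim ∫⁻|∇u(tₙ)|²_F = ∫⁻|∇u₀|²_F`, and the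
`H¹` div–curl inequality gives the reverse. [cite: Tao2011, Thm. 5.4 (i)-(ii) and Prop. 5.6] -/
theorem continuousWithinAt_lintegral_curl_zero (hν : 0 < ν) (hsol : IsSol ν T u₀ u p) (hd : IsDatum u₀)
    (hT : 0 < T) :
    ContinuousWithinAt (fun t => ∫⁻ x, ‖curl (u t) x‖ₑ ^ 2) (Ico 0 T) 0 := by
  obtain ⟨T₁, hT₁, hT₁T, hW⟩ := exists_continuousOn_lintegral_frob hν hsol hd hT
  set G : ℝ → ℝ≥0∞ := fun t => ∫⁻ x, ENNReal.ofReal (frobeniusNormSq (fderiv ℝ (u t) x)) with hG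
  set V : ℝ → ℝ≥0∞ := fun t => ∫⁻ x, ‖curl (u t) x‖ₑ ^ 2 with hV
  have h0S : (0 : ℝ) ∈ Ico 0 T := ⟨le_rfl, hT⟩
  -- `G = V` at positive times of the window
  have hGV : ∀ t ∈ Ioc 0 T₁, G t = V t := fun t ht =>
    lintegral_frob_eq_lintegral_curl_of_pos hν hsol ⟨ht.1, ht.2.trans_lt hT₁T⟩
  -- `G 0 ≤ V 0` (the `H¹` div–curl inequality)
  have hus : ContDiff ℝ ∞ (u 0) := hsol.classical.contDiff_velocity h0S
  have hL2 : ∫⁻ x, ‖u 0 x‖ₑ ^ 2 < ⊤ := by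
    obtain ⟨A, hA, hAt⟩ := hsol.energy
    exact (hAt 0 h0S).trans_lt hA
  have hle : G 0 ≤ V 0 :=
    lintegral_frobeniusNormSq_fderiv_le_lintegral_sq_norm_curl (hus.of_le (by norm_cast))
      (hsol.classical.divFree 0 h0S) hL2
  -- Fatou along `tₙ = T₁/(n+2)`
  set s : ℕ → ℝ := fun n => T₁ / ((n : ℝ) + 2) with hs
  have hs_mem : ∀ n, s n ∈ Ioc 0 T₁ := fun n => by
    refine ⟨by positivity, ?_⟩
    rw [hs, div_le_iff₀ (by positivity)]
    nlinarith [Nat.cast_nonneg (α := ℝ) n, hT₁]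
  have hs_tend : Tendsto s atTop (𝓝 0) := by
    have h1 : Tendsto (fun n : ℕ => (n : ℝ) + 2) atTop atTop :=
      tendsto_natCast_atTop_atTop.atTop_add tendsto_const_nhds
    simpa [hs] using tendsto_const_nhds.div_atTop h1
  have hs_Icc : Tendsto s atTop (𝓝[Icc 0 T₁] 0) :=
    tendsto_nhdsWithin_iff.2 ⟨hs_tend, Eventually.of_forall fun n => ⟨(hs_mem n).1.le, (hs_mem n).2⟩⟩
  have hs_Ico : Tendsto s atTop (𝓝[Ico 0 T] 0) :=
    tendsto_nhdsWithin_iff.2 ⟨hs_tend, Eventually.of_forall fun n =>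
      ⟨(hs_mem n).1.le, (hs_mem n).2.trans_lt hT₁T⟩⟩
  -- `G (s n) → G 0`
  have hGlim : Tendsto (fun n => G (s n)) atTop (𝓝 (G 0)) :=
    (hW 0 ⟨le_rfl, hT₁.le⟩).tendsto.comp hs_Icc
  have hVlim : Tendsto (fun n => V (s n)) atTop (𝓝 (G 0)) :=
    hGlim.congr fun n => hGV (s n) (hs_mem n)
  -- pointwise convergence of the vorticity along `s n`
  have hDcont : ContinuousOn (fun z : ℝ × E3 => fderiv ℝ (u z.1) z.2) (Ico 0 T ×ˢ univ) :=
    hsol.classical.smooth_velocity.continuousOn_fderiv_slice (uniqueDiffOn_Ico 0 T)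
  have hpt : ∀ x : E3, Tendsto (fun n => ‖curl (u (s n)) x‖ₑ ^ 2) atTop (𝓝 (‖curl (u 0) x‖ₑ ^ 2)) := by
    intro x
    have hpath : ContinuousWithinAt (fun t : ℝ => ((t, x) : ℝ × E3)) (Ico 0 T) 0 :=
      (continuous_id.prodMk continuous_const).continuousWithinAt
    have hmaps : MapsTo (fun t : ℝ => ((t, x) : ℝ × E3)) (Ico 0 T) (Ico 0 T ×ˢ univ) :=
      fun t ht => ⟨ht, mem_univ _⟩
    have hF : ContinuousWithinAt (fun t => fderiv ℝ (u t) x) (Ico 0 T) 0 :=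
      ContinuousWithinAt.comp (f := fun t : ℝ => ((t, x) : ℝ × E3)) (x := (0 : ℝ))
        (hDcont (0, x) ⟨h0S, mem_univ _⟩) hpath hmaps
    have hC : ContinuousWithinAt (fun t => curl (u t) x) (Ico 0 T) 0 := by
      have : (fun t => curl (u t) x) = fun t => curlCLM (fderiv ℝ (u t) x) := funext fun t => curl_eq_curlCLM _ _
      rw [this]
      exact curlCLM.continuous.continuousAt.comp_continuousWithinAt hF
    have hT := (hC.tendsto.comp hs_Ico)
    exact ((ENNReal.continuous_pow 2).continuousAt.tendsto.comp (continuous_enorm.continuousAt.tendsto.comp hT))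
  have hmeas : ∀ n, Measurable fun x => ‖curl (u (s n)) x‖ₑ ^ 2 := fun n => by
    have hc : ContDiff ℝ 1 (u (s n)) :=
      (hsol.classical.contDiff_velocity ⟨(hs_mem n).1.le, (hs_mem n).2.trans_lt hT₁T⟩).of_le (by norm_cast)
    exact (continuous_curl hc).measurable.enorm.pow_const 2
  have hFatou : V 0 ≤ G 0 := by
    have h := lintegral_liminf_le (μ := (volume : Measure E3)) (u := atTop) hmeas
    have hlhs : ∫⁻ x, liminf (fun n => ‖curl (u (s n)) x‖ₑ ^ 2) atTop = V 0 :=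
      lintegral_congr fun x => (hpt x).liminf_eq
    rw [hlhs, hVlim.liminf_eq] at h
    exact h
  have hGV0 : G 0 = V 0 := le_antisymm hle hFatou
  -- conclusion on the window, then on `[0,T)`
  have hWV : ContinuousWithinAt V (Icc 0 T₁) 0 := by
    refine ((hW 0 ⟨le_rfl, hT₁.le⟩).congr (fun t ht => ?_) hGV0.symm)
    rcases ht.1.eq_or_lt with h0 | hpos
    · rw [← h0]; exact hGV0.symm
    · exact (hGV t ⟨hpos, ht.2⟩).symm
  have hmem : Icc 0 T₁ ∈ 𝓝[Ico 0 T] 0 :=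
    nhdsWithin_mono 0 Ico_subset_Ici_self (Icc_mem_nhdsGE hT₁)
  exact hWV.mono_of_mem_nhdsWithin hmem

/-- **`t ↦ ‖ω(t)‖²_{L²}` is continuous on `[0,T)`** along every class solution (`ν > 0`).
[cite: Magsanop2026, §3 p.3 l.11–12] -/
theorem continuousOn_vortSq (hν : 0 < ν) (hsol : IsSol ν T u₀ u p) (hd : IsDatum u₀) :
    ContinuousOn (fun t => vortSq (u t)) (Ico 0 T) := by
  intro t ht
  rcases ht.1.eq_or_lt with h0 | hpos
  · -- `t = 0`
    subst h0
    have hT : 0 < T := ht.2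
    have hV := continuousWithinAt_lintegral_curl_zero hν hsol hd hT
    have hfin : (∫⁻ x, ‖curl (u 0) x‖ₑ ^ 2) ≠ ⊤ := by
      have hsm : ContDiff ℝ 2 (u 0) := (hsol.classical.contDiff_velocity ht).of_le (by norm_cast)
      have h1 : ∫⁻ x, ‖iteratedFDeriv ℝ 1 (u 0) x‖ₑ ^ 2 < ⊤ := by rw [hsol.initial]; exact hd.2.2 1 le_rfl
      rw [lintegral_enorm_curl_sq_eq_ofReal_integral hsm h1]
      exact ENNReal.ofReal_ne_top
    have h := (ENNReal.tendsto_toReal hfin).comp hV.tendsto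
    refine (ContinuousWithinAt.congr h (fun s hs => ?_) ?_)
    · exact vortSq_eq_toReal hν hsol hd hs
    · exact vortSq_eq_toReal hν hsol hd ht
  · exact (hasDerivAt_vortSq hν hsol ⟨hpos, ht.2⟩).continuousAt.continuousWithinAt

/-- **`Step_L22_ineq` HOLDS** (§3 p.2 l.48 – p.3 l.16): with the absolute constant `C = 4K⁶ + 1`, along every class
solution from a datum of the class, `t ↦ ‖ω(t)‖²_{L²}` is continuous on `[0,T)`, differentiable on `(0,T)`, and
`d/dt‖ω‖² + ν‖∇ω‖² ≤ Cν⁻³‖∇u‖⁴‖ω‖²` there. [cite: Magsanop2026, §3 p.2 l.48 – p.3 l.16] [cite: Evans2010, §5.6.1 Thm. 1–2]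
[cite: Tao2011, Cor. 11.1, Thm. 5.4, Prop. 5.6] -/
theorem step_L22_ineq_holds : Step_L22_ineq := by
  refine ⟨4 * (SNormLESNormFDerivOfEqConst E3 (volume : Measure E3) 2 : ℝ) ^ 6 + 1, C22_pos, ?_⟩
  intro ν hν u₀ hd T u p hsol
  exact ⟨continuousOn_vortSq hν hsol hd, fun t ht => step_L22_ineq_interior hν hsol ht⟩

end Summit.NavierStokesRegularity.NavierStokesRegularity.Theorems.Magsanop2026Enstrophy

end
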